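import Summits.HubbardSuperconductivity.HubbardSuperconductivity.Theorems.NodalDiracTwistTwistCalibrationBdGRotation

/-!
# Route `NodalDiracTwist` — support `TwistCalibrationBdG`: the diagonal form and the half-filled sector

Fourth helper file for stmt-HubbardSuperconductivity-1625: with `V = bdgV = Γ(U)ᴴ W`,
* `partialParticleHole_conj_eq_Gamma_conj`: `W H(φ) Wᴴ = Γ(U)(Σ_{o'} e(o') n_{o'} + (Σ_k ξ_k)·1)Γ(U)ᴴ`;
* `sourcedSpinTwistedHubbardTorus_zero_mulVec`: `H(φ)ψ = Vᴴ (Σ e n) V ψ + (Σ_k ξ_k) ψ` and the isometry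
  lemmas for `V`, `Vᴴ` (stated in `mulVec`/`dotProduct` form, which does not expose the `DecidableEq`
  instance hidden in `(1 : Matrix _ _ ℂ)` at the concrete orbital type);
* the sector: `W S^z Wᴴ = ½(N - |Λ|)`, `Γ(g) N = N Γ(g)`, and **`S^z ψ = 0 ↔ Vψ` has `L²` particles**
  (`spinZ_mulVec_eq_zero_iff`).

Sources: de Gennes (1966) Ch. 5; Lieb, PRL 62 (1989) 1201, proof of Thm 2; Bratteli–Robinson II §5.2.1.
No definitions.
-/

-- the mandated namespace `Summit.<Summit>.<Problem>.Theorems` repeats `HubbardSuperconductivity`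
-- (single-problem summit, D-0017), which the `dupNamespace` linter flags on every declaration
set_option linter.dupNamespace false

namespace Summit.HubbardSuperconductivity.HubbardSuperconductivity.Theorems.NodalDiracTwist

open Matrix Finset Literature.Probability.LatticeModels Literature.MathematicalPhysics.QuantumLattice
open scoped ComplexConjugate

variable {d L : ℕ} [NeZero L]

/-! ### The diagonal form -/

section Diagonal

/-- Lieb's transformation on the two-dimensional torus (local notation). -/
local notation "𝓦₂" => partialParticleHole (spinDownOrbitals : Finset (Orb (FermionTorus 2 L)))

/-- The energy-weighted occupation numbers of the Bogoliubov modes resum to the Nambu blocks: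
`Σ_{o'} e(o') n(U e_{o'}) = Σ_k Q_k(ξ_k, hĝ_k)`. [folklore] -/
theorem sum_bdgModeEnergy_smul_numberMode (μ₀ h : ℝ) (φ : Fin d → ℝ) :
    ∑ o' : Orb (FermionTorus d L), ((bdgModeEnergy L μ₀ h φ o' : ℝ) : ℂ) •
        RayleighBound.numberMode (fun o => bdgModeMatrix L μ₀ h φ o o') =
      ∑ k : TorusSite d L, nambuQuad L k (twistXi L μ₀ φ k) (h * twistPairSymbol L φ k) := by
  rw [sum_orb_eq_sum_sum, FermionTorus.sum_eq_sum_torusSite]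
  refine Finset.sum_congr rfl fun k _ => ?_
  rw [Fin.sum_univ_two, bdgModeMatrix_col, bdgModeMatrix_col]
  simp only [bdgModeEnergy, ofLex_orb, FermionTorus.toTorusSite_ofTorusSite, if_true, one_ne_zero,
    if_false, bdgSpinor]
  have hz : (‖((twistXi L μ₀ φ k : ℝ) : ℂ) + ((h * twistPairSymbol L φ k : ℝ) : ℂ) * Complex.I‖ : ℂ) *
      nambuLower (twistNambuZ L μ₀ h φ k) ^ 2 =
      -(((twistXi L μ₀ φ k : ℝ) : ℂ) + ((h * twistPairSymbol L φ k : ℝ) : ℂ) * Complex.I) :=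
    norm_mul_nambuLower_sq _
  rw [nambuQuad_eq_norm_smul k _ _ (nambuLower (twistNambuZ L μ₀ h φ k)) hz, Complex.ofReal_neg,
    neg_smul, ← sub_eq_add_neg, ← smul_sub, twistNambuZ]

/-- **The diagonal form of the `U = 0` sourced spin-twisted family.** With Lieb's transformation `W`,
the Bogoliubov mode matrix `U = bdgModeMatrix` and `e = bdgModeEnergy`,
`W H(φ) Wᴴ = Γ(U) (Σ_{o'} e(o') n_{o'} + (Σ_k ξ_k)·1) Γ(U)ᴴ`: the many-body Hamiltonian is unitarily
equivalent to a real combination of occupation numbers, i.e. to a diagonal matrix in the occupation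
basis (`sum_smul_numberAt_mulVec`). de Gennes (1966) Ch. 5; Bratteli–Robinson II §5.2. [folklore] -/
theorem partialParticleHole_conj_eq_Gamma_conj (μ₀ h : ℝ) (φ : Fin 2 → ℝ) :
    𝓦₂ * sourcedSpinTwistedHubbardTorus L 0 μ₀ h φ * 𝓦₂ᴴ =
      Gamma (bdgModeMatrix L μ₀ h φ) *
        ((∑ o' : Orb (FermionTorus 2 L), ((bdgModeEnergy L μ₀ h φ o' : ℝ) : ℂ) • numberAt o') +
          ((∑ k : TorusSite 2 L, twistXi L μ₀ φ k : ℝ) : ℂ) •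
            (1 : Matrix (Finset (Orb (FermionTorus 2 L))) (Finset (Orb (FermionTorus 2 L))) ℂ)) *
        (Gamma (bdgModeMatrix L μ₀ h φ))ᴴ := by
  have hU := bdgModeMatrix_mul_conjTranspose_self (L := L) μ₀ h φ
  have hU' := bdgModeMatrix_conjTranspose_mul_self (L := L) μ₀ h φ
  have hG : Gamma (bdgModeMatrix L μ₀ h φ) * (Gamma (bdgModeMatrix L μ₀ h φ))ᴴ = 1 := by
    rw [← Gamma_conjTranspose, ← Gamma_mul, hU]
    convert Gamma_one (ι := Orb (FermionTorus 2 L))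
  rw [partialParticleHole_conj_sourcedSpinTwistedHubbardTorus, Matrix.mul_add, Matrix.add_mul,
    Matrix.mul_smul, Matrix.mul_one, Matrix.smul_mul, hG, Finset.mul_sum, Finset.sum_mul,
    ← sum_bdgModeEnergy_smul_numberMode]
  congr 1
  refine Finset.sum_congr rfl fun o' _ => ?_
  rw [Matrix.mul_smul, Matrix.smul_mul, Gamma_conj_numberAt hU hU']


/-! ### The sector `ker S^z` becomes the half-filled sector -/

section Sector

variable {Λ : Type*} [LinearOrder Λ] [Fintype Λ]

/-- `W S^z Wᴴ = ½ (N - |Λ|)`: after Lieb's transformation the spin imbalance is the total particle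
number measured from half filling. Lieb (1989), proof of Theorem 2. [folklore] -/
theorem partialParticleHole_conj_spinZ :
    partialParticleHole (spinDownOrbitals : Finset (Orb Λ)) * HubbardWave0.spinZ *
        (partialParticleHole (spinDownOrbitals : Finset (Orb Λ)))ᴴ =
      (1 / 2 : ℂ) • (totalNumberOp -
        (Fintype.card Λ : ℂ) • (1 : Matrix (Finset (Orb Λ)) (Finset (Orb Λ)) ℂ)) := by
  rw [HubbardWave0.spinZ, partialParticleHole_conj_smul, partialParticleHole_conj_sum,
    totalNumberOp_eq_totalNumber]
  congr 1
  have hx : ∀ x : Λ, partialParticleHole (spinDownOrbitals : Finset (Orb Λ)) *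
      (numberOp x 0 - numberOp x 1) * (partialParticleHole (spinDownOrbitals : Finset (Orb Λ)))ᴴ =
      (numberOp x 0 + numberOp x 1) - 1 := by
    intro x
    rw [Matrix.mul_sub, Matrix.sub_mul, partialParticleHole_conj_numberOp_up,
      partialParticleHole_conj_numberOp_down]
    abel
  simp only [hx, Finset.sum_sub_distrib, totalNumber, Fin.sum_univ_two, Finset.sum_const,
    Finset.card_univ]
  rw [← Nat.cast_smul_eq_nsmul ℂ]

/-- `Γ(g)` preserves the particle number: `Γ(g) N = N Γ(g)`. Bratteli–Robinson II §5.2.1.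
[folklore] -/
theorem Gamma_mul_totalNumberOp_comm {ι : Type*} [LinearOrder ι] [Fintype ι] (g : Matrix ι ι ℂ) :
    Gamma g * totalNumberOp = totalNumberOp * Gamma g := by
  rw [totalNumberOp_eq_diagonal]
  ext S T
  rw [mul_diagonal, diagonal_mul]
  by_cases hST : S.card = T.card
  · rw [hST, mul_comm]
  · rw [Gamma_apply_of_card_ne g hST, mul_zero, zero_mul]

/-- For a one-body unitary `g`, the unitary `V = Γ(g)ᴴ W` conjugates `S^z` to `½(N - |Λ|)`.
[folklore] -/
theorem Gamma_conjTranspose_partialParticleHole_conj_spinZ {g : Matrix (Orb Λ) (Orb Λ) ℂ}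
    (hg : gᴴ * g = 1) :
    (Gamma g)ᴴ * partialParticleHole (spinDownOrbitals : Finset (Orb Λ)) * HubbardWave0.spinZ *
        ((Gamma g)ᴴ * partialParticleHole (spinDownOrbitals : Finset (Orb Λ)))ᴴ =
      (1 / 2 : ℂ) • (totalNumberOp -
        (Fintype.card Λ : ℂ) • (1 : Matrix (Finset (Orb Λ)) (Finset (Orb Λ)) ℂ)) := by
  have hG : (Gamma g)ᴴ * Gamma g = 1 := by rw [← Gamma_conjTranspose, ← Gamma_mul, hg, Gamma_one]
  rw [conjTranspose_mul, conjTranspose_conjTranspose]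
  calc (Gamma g)ᴴ * partialParticleHole spinDownOrbitals * HubbardWave0.spinZ *
        ((partialParticleHole spinDownOrbitals)ᴴ * Gamma g)
      = (Gamma g)ᴴ * (partialParticleHole spinDownOrbitals * HubbardWave0.spinZ *
          (partialParticleHole (spinDownOrbitals : Finset (Orb Λ)))ᴴ) * Gamma g := by
        simp only [Matrix.mul_assoc]
    _ = _ := by
        rw [partialParticleHole_conj_spinZ, Matrix.mul_smul, Matrix.smul_mul, Matrix.mul_sub,
          Matrix.sub_mul, Matrix.mul_smul, Matrix.smul_mul, Matrix.mul_one, hG, Matrix.mul_assoc,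
          ← Gamma_mul_totalNumberOp_comm, ← Matrix.mul_assoc, hG, Matrix.one_mul]

/-- **The sector lemma.** For a one-body unitary `g` and `V = Γ(g)ᴴ W`: `S^z ψ = 0` iff `V ψ` has
exactly `|Λ|` particles. [folklore] -/
theorem spinZ_mulVec_eq_zero_iff_isNParticle {g : Matrix (Orb Λ) (Orb Λ) ℂ} (hg : gᴴ * g = 1)
    (hg' : g * gᴴ = 1) (ψ : Fock (Orb Λ)) :
    HubbardWave0.spinZ *ᵥ ψ = 0 ↔ IsNParticle (Fintype.card Λ)
      (((Gamma g)ᴴ * partialParticleHole (spinDownOrbitals : Finset (Orb Λ))) *ᵥ ψ) := by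
  have hG : (Gamma g)ᴴ * Gamma g = 1 := by rw [← Gamma_conjTranspose, ← Gamma_mul, hg, Gamma_one]
  have hG' : Gamma g * (Gamma g)ᴴ = 1 := by rw [← Gamma_conjTranspose, ← Gamma_mul, hg', Gamma_one]
  have hP := partialParticleHole_conjTranspose_mul (spinDownOrbitals : Finset (Orb Λ))
  have hP' := partialParticleHole_mul_conjTranspose (spinDownOrbitals : Finset (Orb Λ))
  have hV : ((Gamma g)ᴴ * partialParticleHole (spinDownOrbitals : Finset (Orb Λ)))ᴴ *
      ((Gamma g)ᴴ * partialParticleHole (spinDownOrbitals : Finset (Orb Λ))) = 1 := by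
    rw [conjTranspose_mul, conjTranspose_conjTranspose]
    calc (partialParticleHole spinDownOrbitals)ᴴ * Gamma g *
          ((Gamma g)ᴴ * partialParticleHole (spinDownOrbitals : Finset (Orb Λ)))
        = (partialParticleHole spinDownOrbitals)ᴴ * (Gamma g * (Gamma g)ᴴ) *
            partialParticleHole (spinDownOrbitals : Finset (Orb Λ)) := by simp only [Matrix.mul_assoc]
      _ = 1 := by rw [hG', Matrix.mul_one, hP]
  have hV' : ((Gamma g)ᴴ * partialParticleHole (spinDownOrbitals : Finset (Orb Λ))) *
      ((Gamma g)ᴴ * partialParticleHole (spinDownOrbitals : Finset (Orb Λ)))ᴴ = 1 := by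
    rw [conjTranspose_mul, conjTranspose_conjTranspose]
    calc (Gamma g)ᴴ * partialParticleHole (spinDownOrbitals : Finset (Orb Λ)) *
          ((partialParticleHole spinDownOrbitals)ᴴ * Gamma g)
        = (Gamma g)ᴴ * (partialParticleHole (spinDownOrbitals : Finset (Orb Λ)) *
            (partialParticleHole spinDownOrbitals)ᴴ) * Gamma g := by simp only [Matrix.mul_assoc]
      _ = 1 := by rw [hP', Matrix.mul_one, hG]
  have hconj := Gamma_conjTranspose_partialParticleHole_conj_spinZ hg
  -- `S^z = Vᴴ M V`
  have hS : ∀ χ : Fock (Orb Λ), HubbardWave0.spinZ *ᵥ χ =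
      ((Gamma g)ᴴ * partialParticleHole (spinDownOrbitals : Finset (Orb Λ)))ᴴ *ᵥ
        (((1 / 2 : ℂ) • (totalNumberOp - (Fintype.card Λ : ℂ) • (1 : Matrix _ _ ℂ))) *ᵥ
          (((Gamma g)ᴴ * partialParticleHole (spinDownOrbitals : Finset (Orb Λ))) *ᵥ χ)) := by
    intro χ
    rw [← hconj, mulVec_mulVec, mulVec_mulVec]
    congr 1
    calc HubbardWave0.spinZ
        = (((Gamma g)ᴴ * partialParticleHole (spinDownOrbitals : Finset (Orb Λ)))ᴴ *
            ((Gamma g)ᴴ * partialParticleHole (spinDownOrbitals : Finset (Orb Λ)))) * HubbardWave0.spinZ *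
            (((Gamma g)ᴴ * partialParticleHole (spinDownOrbitals : Finset (Orb Λ)))ᴴ *
            ((Gamma g)ᴴ * partialParticleHole (spinDownOrbitals : Finset (Orb Λ)))) := by
          rw [hV, Matrix.one_mul, Matrix.mul_one]
      _ = _ := by simp only [Matrix.mul_assoc]
  have key : ∀ (χ : Fock (Orb Λ)) s, (((1 / 2 : ℂ) • (totalNumberOp -
      (Fintype.card Λ : ℂ) • (1 : Matrix _ _ ℂ))) *ᵥ χ) s = (1 / 2 : ℂ) * (((s.card : ℂ) - Fintype.card Λ) * χ s) := by
    intro χ s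
    rw [smul_mulVec, Pi.smul_apply, sub_mulVec, Pi.sub_apply, totalNumberOp_eq_diagonal,
      mulVec_diagonal, smul_mulVec, one_mulVec, Pi.smul_apply, smul_eq_mul, smul_eq_mul, ← sub_mul]
  constructor
  · intro h0 s hs
    -- apply `V` to `S^z ψ = 0`
    have h2 := congrArg (fun χ => ((Gamma g)ᴴ * partialParticleHole (spinDownOrbitals : Finset (Orb Λ))) *ᵥ χ) h0
    simp only [mulVec_zero] at h2
    rw [hS, mulVec_mulVec, hV', one_mulVec] at h2
    have h3 := congrFun h2 s
    rw [key, Pi.zero_apply, mul_eq_zero, mul_eq_zero] at h3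
    rcases h3 with h3 | h3 | h3
    · norm_num at h3
    · exfalso; apply hs
      have h4 : ((s.card : ℕ) : ℂ) = ((Fintype.card Λ : ℕ) : ℂ) := sub_eq_zero.mp h3
      exact_mod_cast h4
    · exact h3
  · intro hN
    have h1 : ((1 / 2 : ℂ) • (totalNumberOp - (Fintype.card Λ : ℂ) • (1 : Matrix _ _ ℂ))) *ᵥ
        (((Gamma g)ᴴ * partialParticleHole (spinDownOrbitals : Finset (Orb Λ))) *ᵥ ψ) = 0 := by
      funext s
      rw [key, Pi.zero_apply]
      by_cases hs : s.card = Fintype.card Λ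
      · rw [hs, sub_self, zero_mul, mul_zero]
      · rw [hN s hs, mul_zero, mul_zero]
    rw [hS, h1, mulVec_zero]

end Sector

section TorusDiagonal

/-- `Vᴴ (V χ) = χ`. [folklore] -/
theorem bdgV_conjTranspose_mulVec_mulVec (μ₀ h : ℝ) (φ : Fin 2 → ℝ)
    (χ : Fock (Orb (FermionTorus 2 L))) :
    (bdgV L μ₀ h φ)ᴴ *ᵥ (bdgV L μ₀ h φ *ᵥ χ) = χ := by
  have hG : Gamma (bdgModeMatrix L μ₀ h φ) * (Gamma (bdgModeMatrix L μ₀ h φ))ᴴ = 1 := by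
    rw [← Gamma_conjTranspose, ← Gamma_mul, bdgModeMatrix_mul_conjTranspose_self]
    convert Gamma_one (ι := Orb (FermionTorus 2 L))
  have hW : 𝓦₂ᴴ * 𝓦₂ = 1 := by
    convert partialParticleHole_conjTranspose_mul (spinDownOrbitals : Finset (Orb (FermionTorus 2 L)))
  rw [mulVec_mulVec, bdgV, conjTranspose_mul, conjTranspose_conjTranspose, Matrix.mul_assoc,
    ← Matrix.mul_assoc (Gamma _), hG, Matrix.one_mul, hW, one_mulVec]

/-- `V (Vᴴ χ) = χ`. [folklore] -/
theorem bdgV_mulVec_conjTranspose_mulVec (μ₀ h : ℝ) (φ : Fin 2 → ℝ)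
    (χ : Fock (Orb (FermionTorus 2 L))) :
    bdgV L μ₀ h φ *ᵥ ((bdgV L μ₀ h φ)ᴴ *ᵥ χ) = χ := by
  have hG : (Gamma (bdgModeMatrix L μ₀ h φ))ᴴ * Gamma (bdgModeMatrix L μ₀ h φ) = 1 := by
    rw [← Gamma_conjTranspose, ← Gamma_mul, bdgModeMatrix_conjTranspose_mul_self]
    convert Gamma_one (ι := Orb (FermionTorus 2 L))
  have hW : 𝓦₂ * 𝓦₂ᴴ = 1 := by
    convert partialParticleHole_mul_conjTranspose (spinDownOrbitals : Finset (Orb (FermionTorus 2 L)))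
  rw [mulVec_mulVec, bdgV, conjTranspose_mul, conjTranspose_conjTranspose, Matrix.mul_assoc,
    ← Matrix.mul_assoc (partialParticleHole _), hW, Matrix.one_mul, hG, one_mulVec]

/-- `V` is an isometry: `⟨Vχ, Vχ'⟩ = ⟨χ, χ'⟩`. [folklore] -/
theorem star_bdgV_mulVec_dotProduct (μ₀ h : ℝ) (φ : Fin 2 → ℝ)
    (χ χ' : Fock (Orb (FermionTorus 2 L))) :
    star (bdgV L μ₀ h φ *ᵥ χ) ⬝ᵥ (bdgV L μ₀ h φ *ᵥ χ') = star χ ⬝ᵥ χ' := by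
  rw [star_mulVec, ← dotProduct_mulVec, mulVec_mulVec, ← mulVec_mulVec, ← star_eq_conjTranspose]
  change star χ ⬝ᵥ ((bdgV L μ₀ h φ)ᴴ *ᵥ (bdgV L μ₀ h φ *ᵥ χ')) = _
  rw [bdgV_conjTranspose_mulVec_mulVec]

/-- `Vᴴ` is an isometry: `⟨Vᴴχ, Vᴴχ'⟩ = ⟨χ, χ'⟩`. [folklore] -/
theorem star_bdgV_conjTranspose_mulVec_dotProduct (μ₀ h : ℝ) (φ : Fin 2 → ℝ)
    (χ χ' : Fock (Orb (FermionTorus 2 L))) :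
    star ((bdgV L μ₀ h φ)ᴴ *ᵥ χ) ⬝ᵥ ((bdgV L μ₀ h φ)ᴴ *ᵥ χ') = star χ ⬝ᵥ χ' := by
  rw [star_mulVec, ← dotProduct_mulVec, mulVec_mulVec, ← mulVec_mulVec, ← star_eq_conjTranspose,
    star_eq_conjTranspose, conjTranspose_conjTranspose]
  change star χ ⬝ᵥ (bdgV L μ₀ h φ *ᵥ ((bdgV L μ₀ h φ)ᴴ *ᵥ χ')) = _
  rw [bdgV_mulVec_conjTranspose_mulVec]

/-- **The action of `H(φ)` through the diagonalising unitary**: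
`H(φ) ψ = Vᴴ D V ψ + (Σ_k ξ_k) ψ` with `D = Σ_{o'} e(o') n_{o'}` diagonal in the occupation basis
(`sum_smul_numberAt_mulVec`). de Gennes (1966) Ch. 5. [folklore] -/
theorem sourcedSpinTwistedHubbardTorus_zero_mulVec (μ₀ h : ℝ) (φ : Fin 2 → ℝ)
    (ψ : Fock (Orb (FermionTorus 2 L))) :
    sourcedSpinTwistedHubbardTorus L 0 μ₀ h φ *ᵥ ψ =
      (bdgV L μ₀ h φ)ᴴ *ᵥ ((∑ o' : Orb (FermionTorus 2 L),
          ((bdgModeEnergy L μ₀ h φ o' : ℝ) : ℂ) • numberAt o') *ᵥ (bdgV L μ₀ h φ *ᵥ ψ)) +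
        ((∑ k : TorusSite 2 L, twistXi L μ₀ φ k : ℝ) : ℂ) • ψ := by
  have hkey := partialParticleHole_conj_eq_Gamma_conj (L := L) μ₀ h φ
  have hW : 𝓦₂ᴴ * 𝓦₂ = 1 := by
    convert partialParticleHole_conjTranspose_mul (spinDownOrbitals : Finset (Orb (FermionTorus 2 L)))
  have hG : Gamma (bdgModeMatrix L μ₀ h φ) * (Gamma (bdgModeMatrix L μ₀ h φ))ᴴ = 1 := by
    rw [← Gamma_conjTranspose, ← Gamma_mul, bdgModeMatrix_mul_conjTranspose_self]
    convert Gamma_one (ι := Orb (FermionTorus 2 L))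
  have hH : sourcedSpinTwistedHubbardTorus L 0 μ₀ h φ =
      𝓦₂ᴴ * (𝓦₂ * sourcedSpinTwistedHubbardTorus L 0 μ₀ h φ * 𝓦₂ᴴ) * 𝓦₂ := by
    simp only [Matrix.mul_assoc]
    rw [hW, Matrix.mul_one, ← Matrix.mul_assoc, hW, Matrix.one_mul]
  have hmat : sourcedSpinTwistedHubbardTorus L 0 μ₀ h φ =
      (bdgV L μ₀ h φ)ᴴ * (∑ o' : Orb (FermionTorus 2 L),
          ((bdgModeEnergy L μ₀ h φ o' : ℝ) : ℂ) • numberAt o') * bdgV L μ₀ h φ +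
        ((∑ k : TorusSite 2 L, twistXi L μ₀ φ k : ℝ) : ℂ) •
          (1 : Matrix (Finset (Orb (FermionTorus 2 L))) (Finset (Orb (FermionTorus 2 L))) ℂ) := by
    rw [hH, hkey, bdgV, conjTranspose_mul, conjTranspose_conjTranspose]
    simp only [Matrix.mul_add, Matrix.add_mul, Matrix.mul_smul, Matrix.smul_mul, Matrix.mul_one,
      Matrix.mul_assoc]
    rw [← Matrix.mul_assoc (Gamma _) (Gamma _)ᴴ, hG, Matrix.one_mul, hW]
  conv_lhs => rw [hmat]
  rw [add_mulVec, smul_mulVec, one_mulVec, ← mulVec_mulVec, ← mulVec_mulVec]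

/-- **The sector on the torus**: `S^z ψ = 0 ↔ V ψ` has `L²` particles. [folklore] -/
theorem spinZ_mulVec_eq_zero_iff (μ₀ h : ℝ) (φ : Fin 2 → ℝ) (ψ : Fock (Orb (FermionTorus 2 L))) :
    HubbardWave0.spinZ *ᵥ ψ = 0 ↔
      IsNParticle (Fintype.card (FermionTorus 2 L)) (bdgV L μ₀ h φ *ᵥ ψ) := by
  rw [bdgV]
  refine spinZ_mulVec_eq_zero_iff_isNParticle ?_ ?_ ψ
  · convert bdgModeMatrix_conjTranspose_mul_self (L := L) μ₀ h φ
  · convert bdgModeMatrix_mul_conjTranspose_self (L := L) μ₀ h φ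

end TorusDiagonal

end Diagonal

end Summit.HubbardSuperconductivity.HubbardSuperconductivity.Theorems.NodalDiracTwist
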